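import Summits.BirchSwinnertonDyer.BirchSwinnertonDyer.Theorems.SignedLowerHalvesSprungLowerDivisibilityAtThreeErratumField
import HarnessLib
import HarnessLib.Audit.Tags

/-!
# Leaf X8 (`p = 3`, good supersingular): the ONE residual of the ERRATUM-FIELD anticyclotomic road as a NAMED
# `Prop`, `a₃`-free (so that cells `bsd-print-x6` — item 20285 `EisensteinHalfAtThree` — and `bsd-ssimc`/K3
# import ONE declaration), in two strengths (SEMISTABLE = «Castella–Wan 2024 Thm. 5.3 read at `p = 3`»;
# GENERAL = the `⊂` half of Castella–Wan 2024 Conj. 5.2 at `p = 3`), with the X8 consumers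
# (cell `bsd-print-x8`, prover seat p4 «anticyclotomic ♯♭ / TWC road», gen 2, on the planner's ask plan g6
# 21:17:13Z (C)(i) and the literature seat's binder audit lit g13 T29 (b); `--supports`
# stmt-BirchSwinnertonDyer-19004; DEFINITIONS = two `@[conjecture]` `Prop`s, nothing asserted; THEOREMS =
# the implication and the two X8 consumers; closes nothing)

HONEST FRAMING (cell `bsd-print-x8`, HOME `run/shared/lean/pub/bsd-print-x8/`, D-0131 (2) PRINT TIER).
PARTITION currency: the leaf `Summit.BirchSwinnertonDyer.WAllCornerX8` counts only when proved BY NAME, flag-free;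
this file does NOT prove it; «beyond-print theorem: NO»; 0 cells move. The seat's erratum-field road
(`Theorems/SignedLowerHalves{SharpFlatResiduePPart,SprungLowerDivisibilityAtThree}ErratumField*.lean`,
p565026 / p566031 / p566510 / p567675 / p568890) proves `BSD(E,3)` on X8 ∧ {`ρ̄_{E,3}` onto} ∧ {r_an ≤ 1} ∧
{∃ odd nonsplit-multiplicative `q`, `3 ∤ v_q(Δ_min)`} (111 of the 217 census cells) from TWELVE published named
facts and ONE displayed link — the hypothesis `hLA` of `X8.bsdp_erratum_of_onTreeGoodIMC`. This file gives that
hypothesis a NAME, quantified over `GoodSS W 3` (any `a₃ ∈ {0, ±3}`) so that the same declaration is the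
erratum-cell residual of X6 at `3` and of X8:

* `AnticyclotomicLowerDivisibilityAtThreeErratum` (GENERAL; `@[conjecture]`, nothing asserted): for every
  globally minimal `W` with good supersingular reduction at `3`, every ODD nonsplit-multiplicative `q` with
  `3 ∤ v_q(Δ_min)`, every imaginary quadratic `K` meeting the erratum splitting clauses for `q` (`q ∣ d_K`, every
  other bad prime split, `2` split if `2 ∤ N`, `3` split), every Manin-unit Heegner datum (`3 ∤ c`) with `P` of
  infinite order, every anticyclotomic `κ`, generator `γ`, degree-one `𝔭 ∋ 3`:
  `X11b.IMCLowerWaldspurgerOnTreeGoodAt 3 κ 𝔭 γ (X11b.embAt K 3 𝔭) P` — ONE divisibility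
  («`char_Λ(X_ac)Λ^ur ⊂ (𝓛^BDP)`», the `⊂` half of Castella–Wan 2024 Conj. 5.2) at `𝟙` composed with the BDP
  formula.
* `AnticyclotomicLowerDivisibilityAtThreeErratumSemistable` (the same with `Semistable W`, i.e. `N`
  square-free = Castella–Wan 2024 Thm. 5.3 (i)): «Thm. 5.3 ∘ BDP formula with "`p ≥ 5`" read "`p = 3`"» EXACTLY.
* `anticyclotomicLowerDivisibilityAtThreeErratumSemistable_of_general` (GENERAL ⇒ SEMISTABLE), and the X8
  consumers `X8.bsdp_erratum_of_cruxErr` (GENERAL + 12 facts ⇒ `BSD(E,3)` on the 111-cell locus) and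
  `X8.bsdp_erratum_of_cruxErrSemistable` (SEMISTABLE Prop + 12 facts ⇒ `BSD(E,3)` on the 40 semistable locus
  cells: 24 of rank 0, 16 of rank 1).

DISTANCE TO PRINT, binder by binder (cell literature seat lit g13, DOSSIER v2.5 T29 (b), read AT THE PAGE).
(1) The BDP half of the link is IN PRINT at `p = 3` for every `N`: Bertolini–Darmon–Prasanna 2013 Assumption
5.12 + Thm. 5.13 (`p` split, `p ∤ N·c`, `d_K` odd, an ideal of norm `N` — no «`p ≥ 5`», no «square-free») via
Castella–Grossi–Lee–Skinner 2022 Thm. 5.1.3 («`p > 2`»); `d_K` odd is forced here (`2` always splits). So the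
beyond-print content of either Prop is exactly the `⊂`-divisibility at `3`. (2) SEMISTABLE Prop: Castella–Wan,
Math. Ann. 389 (2024) Thm. 5.3 — (i) `N` square-free, (ii) a prime of `N` non-split in `K` (the ramified `q`),
(iii) `2` split if `N` odd; integral at `N⁻ = 1` — whose §2 setting reads «let `p ≥ 5`»; its engine
Castella–Liu–Wan, FMS 10 (2022) Thm. 8.2.3 (1) is printed for «`p ≥ 3`», any slope; Hsieh's `μ = 0` and CGLS
5.1.3 for `p > 2`; the descent (5.2)–(5.5) is written under the standing `p ≥ 5`. NOT in print at `3`; flags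
travelling with the `p ≥ 5` fact: `CW24-CLW22-addendum`, `Hid04-gap`, the cell ruling GAP(G2) on CLW22 at `ξ = 𝟙`.
(3) GENERAL Prop on a NON-square-free `N` (71 of the 111 cells): Castella–Wan 2024 **Conj. 5.2** (`⊂` half);
no non-ordinary Eisenstein-side theorem without «square-free» is printed at ANY `p` (lit g13 presearch; nearest
preprint Burungale–Skinner–Tian–Wan arXiv:2409.01350 Thm. 9.24). Bertolini–Longo–Venerucci-type results (Math. Ann.
2026, arXiv:2306.17784, Thm. A) are `p ≥ 5` with every bad prime INERT — a third field type, not this one.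

References: [CastellaWan2023] §2 (MS p. 5), Def. 5.1, Conj. 5.2, Thm. 5.3 (MS pp. 23–25), proof of Thm. 6.11 (MS
p. 33); [CastellaLiuWan2022] §5.2, Thm. 8.2.3 (1); [BertoliniDarmonPrasanna2013] Assumption 5.12, Thm. 5.13;
[CastellaGrossiLeeSkinner2022] Thm. 5.1.3; [JetchevSkinnerWan2017] §7.4.1 (eq:lowerbound-1);
[BurungaleSkinnerTianWan2024] Thm. 9.24 (PRE); [Miller2011LMS] Def. 1.1.
-/

set_option autoImplicit false
set_option linter.dupNamespace false

noncomputable section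

open scoped Classical

open WeierstrassCurve NumberField IsDedekindDomain Literature.NumberTheory.EllipticCurves
  Literature.NumberTheory.EllipticCurves.ModularForms
  Literature.NumberTheory.EllipticCurves.Rank1Residual
  Literature.NumberTheory.EllipticCurves.Rank1Residual.Typed
  Literature.NumberTheory.EllipticCurves.Wuthrich2014
  Literature.NumberTheory.EllipticCurves.JetchevSkinnerWan2017
  Summit.BirchSwinnertonDyer.Rank1Residual
  Summit.BirchSwinnertonDyer.Rank1Residual.Supersingular

namespace Summit.BirchSwinnertonDyer.BirchSwinnertonDyer.Theorems.X8ErratumField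

/-! ### The two named residual `Prop`s (nothing asserted) -/

/-- **(A-err@3) The anticyclotomic BDP / Iwasawa–Greenberg LOWER divisibility at `p = 3` AT ERRATUM DATA, good
supersingular reduction at `3` with ANY `a₃ ∈ {0, ±3}`, ANY conductor** (OPEN; nothing asserted; the NAMED
RESIDUAL of the erratum-field road, GENERAL form). For `W` globally minimal with `GoodSS W 3`, an ODD
nonsplit-multiplicative `q` with `3 ∤ v_q(Δ_min)`, `K` imaginary quadratic with `q ∣ d_K`, every other bad
prime split, `2` split if `2 ∤ N`, `3` split, a parametrisation datum of level `N_E` with `3 ∤ c`, Heegner datum,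
`ι(P) = Σ φ(τ_Q)` with `P` of infinite order, `κ` anticyclotomic, `γ`, degree-one `𝔭 ∋ 3`:
`X11b.IMCLowerWaldspurgerOnTreeGoodAt 3 κ 𝔭 γ (X11b.embAt K 3 𝔭) P`. On square-free `N` this is «Castella–Wan 2024
Thm. 5.3 ∘ BDP formula with "`p ≥ 5`" read "`p = 3`"» (see the semistable form); in general it is the `⊂` half
of Castella–Wan 2024 Conj. 5.2 at `𝟙` ∘ BDP formula — the BDP half being IN PRINT at `3` (BDP 2013 Assumption
5.12 + Thm. 5.13 via CGLS 2022 Thm. 5.1.3, `p > 2`), the beyond-print content is the `⊂`-divisibility at `3`.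
[cite: CastellaWan2023, Conj. 5.2 and Thm. 5.3 (MS pp. 23–25) (shape only; nothing asserted)]
[cite: BertoliniDarmonPrasanna2013, Assumption 5.12 and Thm. 5.13 (the BDP formula; in print at p = 3)]
[cite: CastellaGrossiLeeSkinner2022, Thm. 5.1.3 (p > 2)] -/
@[conjecture] def AnticyclotomicLowerDivisibilityAtThreeErratum : Prop :=
  ∀ (W : WeierstrassCurve ℚ) [W.IsElliptic] [W.IsGloballyMinimal] [NeZero (W.conductorNorm ℤ)],
    GoodSS W 3 →
    ∀ (q : ℕ) [Fact q.Prime], q ≠ 2 → Mult W q → ¬ W.HasSplitMultiplicativeReductionAtPrime q →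
      ¬ 3 ∣ padicValInt q W.minimalDiscriminantInt →
    ∀ (K : Type) [Field K] [NumberField K]
      (Dt : ModularParametrizationData W (W.conductorNorm ℤ))
      (H : HeegnerDatum (W.conductorNorm ℤ) (NumberField.discr K)) (ι : K →+* ℂ)
      (P : (W.baseChange K).toAffine.Point),
      IsImaginaryQuadratic K → (q : ℤ) ∣ NumberField.discr K →
      (∀ ℓ : ℕ, ℓ.Prime → ℓ ∣ W.conductorNorm ℤ → ℓ ≠ q →
        ((Ideal.span {(ℓ : ℤ)}).primesOver (𝓞 K)).ncard = 2) →
      (¬ 2 ∣ W.conductorNorm ℤ → ((Ideal.span {(2 : ℤ)}).primesOver (𝓞 K)).ncard = 2) →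
      SatisfiesHeegnerHypothesis 3 K →
      WeierstrassCurve.Affine.Point.map ι.toRatAlgHom P = heegnerPointComplex Dt H →
      ¬ (3 : ℤ) ∣ Dt.c → ¬ IsOfFinAddOrder P →
      ∀ (κ : ZpExtension K 3), κ.IsAnticyclotomic →
        ∀ (γ : Field.absoluteGaloisGroup K) [Fact (κ.IsTopGenerator γ)]
          (𝔭 : HeightOneSpectrum (𝓞 K)) (h𝔭 : (((3 : ℕ) : ℕ) : 𝓞 K) ∈ 𝔭.asIdeal)
          (he : 𝔭.asIdeal.ramificationIdx (𝓞 ℚ) = 1) (hf : 𝔭.asIdeal.inertiaDeg (𝓞 ℚ) = 1),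
          X11b.IMCLowerWaldspurgerOnTreeGoodAt 3 κ 𝔭 γ (X11b.embAt K 3 𝔭 h𝔭 he hf) P

/-- **(A-err@3, SEMISTABLE) — «Castella–Wan 2024 Thm. 5.3 ∘ BDP formula with "`p ≥ 5`" read "`p = 3`"»
EXACTLY** (OPEN; nothing asserted): the general `Prop` restricted to `Semistable W` (`N` square-free = Thm. 5.3
(i); (ii) = the ramified `q`; (iii) = the `2`-clause; `N⁻ = 1` so the divisibility is integral). Shared residual
shape of the semistable erratum cells of X6 at `3` (cell bsd-print-x6, item 20285) and of X8 (40 of the 111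
locus cells). Print status: Thm. 5.3's §2 setting is «`p ≥ 5`»; engine CLW 2022 Thm. 8.2.3 (1) printed for
`p ≥ 3`; NOT in print at `3`. [cite: CastellaWan2023, Thm. 5.3 (MS pp. 23–25) and §2 (MS p. 5) (shape only; nothing asserted)]
[cite: CastellaLiuWan2022, §5.2 and Thm. 8.2.3 (1) (the engine, p ≥ 3; nothing asserted)]
[cite: BertoliniDarmonPrasanna2013, Assumption 5.12 and Thm. 5.13] -/
@[conjecture] def AnticyclotomicLowerDivisibilityAtThreeErratumSemistable : Prop :=
  ∀ (W : WeierstrassCurve ℚ) [W.IsElliptic] [W.IsGloballyMinimal] [NeZero (W.conductorNorm ℤ)],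
    GoodSS W 3 → Semistable W →
    ∀ (q : ℕ) [Fact q.Prime], q ≠ 2 → Mult W q → ¬ W.HasSplitMultiplicativeReductionAtPrime q →
      ¬ 3 ∣ padicValInt q W.minimalDiscriminantInt →
    ∀ (K : Type) [Field K] [NumberField K]
      (Dt : ModularParametrizationData W (W.conductorNorm ℤ))
      (H : HeegnerDatum (W.conductorNorm ℤ) (NumberField.discr K)) (ι : K →+* ℂ)
      (P : (W.baseChange K).toAffine.Point),
      IsImaginaryQuadratic K → (q : ℤ) ∣ NumberField.discr K →
      (∀ ℓ : ℕ, ℓ.Prime → ℓ ∣ W.conductorNorm ℤ → ℓ ≠ q →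
        ((Ideal.span {(ℓ : ℤ)}).primesOver (𝓞 K)).ncard = 2) →
      (¬ 2 ∣ W.conductorNorm ℤ → ((Ideal.span {(2 : ℤ)}).primesOver (𝓞 K)).ncard = 2) →
      SatisfiesHeegnerHypothesis 3 K →
      WeierstrassCurve.Affine.Point.map ι.toRatAlgHom P = heegnerPointComplex Dt H →
      ¬ (3 : ℤ) ∣ Dt.c → ¬ IsOfFinAddOrder P →
      ∀ (κ : ZpExtension K 3), κ.IsAnticyclotomic →
        ∀ (γ : Field.absoluteGaloisGroup K) [Fact (κ.IsTopGenerator γ)]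
          (𝔭 : HeightOneSpectrum (𝓞 K)) (h𝔭 : (((3 : ℕ) : ℕ) : 𝓞 K) ∈ 𝔭.asIdeal)
          (he : 𝔭.asIdeal.ramificationIdx (𝓞 ℚ) = 1) (hf : 𝔭.asIdeal.inertiaDeg (𝓞 ℚ) = 1),
          X11b.IMCLowerWaldspurgerOnTreeGoodAt 3 κ 𝔭 γ (X11b.embAt K 3 𝔭 h𝔭 he hf) P

/-! ### GENERAL ⇒ SEMISTABLE, and the X8 consumers -/

/-- The general residual implies its semistable form (drop the `Semistable W` binder). [cite: CastellaWan2023, Conj. 5.2 and Thm. 5.3] -/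
theorem anticyclotomicLowerDivisibilityAtThreeErratumSemistable_of_general
    (hA : AnticyclotomicLowerDivisibilityAtThreeErratum) :
    AnticyclotomicLowerDivisibilityAtThreeErratumSemistable :=
  fun W _ _ _ hss _ q _ hq2 hq hqns hram K _ _ Dt H ι P hK hqD hsplit h2s hHp hP hc hPinf κ hκ γ _ 𝔭 h𝔭 he hf ↦
    hA W hss q hq2 hq hqns hram K Dt H ι P hK hqD hsplit h2s hHp hP hc hPinf κ hκ γ 𝔭 h𝔭 he hf

/-- **X8 consumer of the GENERAL residual**: (A-err@3) + twelve published named facts ⇒ `BSD(E,3)` on X8 ∧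
{`ρ̄_{E,3}` onto} ∧ {r_an ≤ 1} ∧ {∃ odd nonsplit-multiplicative `q`, `3 ∤ v_q(Δ_min)`} (111 census cells) —
`X8.bsdp_erratum_of_onTreeGoodIMC` (p568890) with its link binder fed by the `Prop`. CONDITIONAL; closes nothing.
[cite: CastellaWan2023, Conj. 5.2 and Thm. 5.3 (MS pp. 23–25)] [cite: JetchevSkinnerWan2017, Thm. 3.3.1, §7.4.1]
[cite: FriedbergHoffstein1995, Thm. B] [cite: Miller2011LMS, §1 and Def. 1.1] -/
theorem X8.bsdp_erratum_of_cruxErr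
    (hGZ : GrossZagier1986_thm_I_7_3) (hGZK : rank_eq_analyticRank_of_analyticRank_le_one)
    (hWu : sha_dvd_analyticSha) (hK13 : Kobayashi2013.rem13_padicValRat_bsd_rank_one_le_of_kato)
    (hnf : exists_isNewformOf) (hMaz : mazur_not_dvd_maninConstant_of_odd)
    (hCST : CaiShuTian2014.thm11_trivialChar)
    (hFH : friedbergHoffstein_exists_twist_ne_zero_ramifiedAt_splitAt)
    (hFH' : friedbergHoffstein_exists_twist_simpleZero_ramifiedAt_splitAt)
    (h331 : thm331_anticyclotomicControl_general)
    (hA : AnticyclotomicLowerDivisibilityAtThreeErratum)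
    (W : WeierstrassCurve ℚ) [W.IsElliptic] [W.IsGloballyMinimal] [NeZero (W.conductorNorm ℤ)]
    (p : ℕ) [Fact p.Prime] (q : ℕ) [Fact q.Prime] (hX : ClassX8 W p) (hsurj : Surj W p)
    (hr : W.analyticRank ≤ 1) (hq2 : q ≠ 2) (hq : Mult W q)
    (hqns : ¬ W.HasSplitMultiplicativeReductionAtPrime q)
    (hram : ¬ p ∣ padicValInt q W.minimalDiscriminantInt) : BSDp W p := by
  have hp3 : p = 3 := hX.1
  subst hp3
  exact X8.bsdp_erratum_of_onTreeGoodIMC hGZ hGZK hWu hK13 hnf hMaz hCST hFH hFH' h331 W 3 q hX hsurj hr hq2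
    hq hqns hram
    (fun K _ _ Dt H ι P hK hqD hsplit h2s hHp hP hc hPinf κ hκ γ _ 𝔭 h𝔭 he hf ↦
      hA W (ClassX8.goodSS W 3 hX) q hq2 hq hqns hram K Dt H ι P hK hqD hsplit h2s hHp hP hc hPinf κ hκ γ 𝔭
        h𝔭 he hf)

/-- **X8 consumer of the SEMISTABLE residual**: (A-err@3, semistable) + twelve published named facts ⇒
`BSD(E,3)` on X8 ∧ {SEMISTABLE} ∧ {r_an ≤ 1} ∧ {∃ odd nonsplit-multiplicative `q`, `3 ∤ v_q(Δ_min)`} (40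
census cells) — `ρ̄_{E,3}` onto by Serre's Prop. 21 i) / Edixhoven 1997 Prop. 2.1 (`ClassX8.surj_of_semistable'`).
CONDITIONAL; closes nothing. [cite: CastellaWan2023, Thm. 5.3 (MS pp. 23–25)] [cite: Serre1972, §5.4 Prop. 21 i)]
[cite: Edixhoven1997, Prop. 2.1] [cite: Miller2011LMS, §1 and Def. 1.1] -/
theorem X8.bsdp_erratum_of_cruxErrSemistable
    (hGZ : GrossZagier1986_thm_I_7_3) (hGZK : rank_eq_analyticRank_of_analyticRank_le_one)
    (hWu : sha_dvd_analyticSha) (hK13 : Kobayashi2013.rem13_padicValRat_bsd_rank_one_le_of_kato)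
    (hnf : exists_isNewformOf) (hMaz : mazur_not_dvd_maninConstant_of_odd)
    (hCST : CaiShuTian2014.thm11_trivialChar)
    (hFH : friedbergHoffstein_exists_twist_ne_zero_ramifiedAt_splitAt)
    (hFH' : friedbergHoffstein_exists_twist_simpleZero_ramifiedAt_splitAt)
    (h331 : thm331_anticyclotomicControl_general)
    (hA : AnticyclotomicLowerDivisibilityAtThreeErratumSemistable)
    (W : WeierstrassCurve ℚ) [W.IsElliptic] [W.IsGloballyMinimal] [NeZero (W.conductorNorm ℤ)]
    (p : ℕ) [Fact p.Prime] (q : ℕ) [Fact q.Prime] (hX : ClassX8 W p) (hsst : Semistable W)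
    (hr : W.analyticRank ≤ 1) (hq2 : q ≠ 2) (hq : Mult W q)
    (hqns : ¬ W.HasSplitMultiplicativeReductionAtPrime q)
    (hram : ¬ p ∣ padicValInt q W.minimalDiscriminantInt) : BSDp W p := by
  have hp3 : p = 3 := hX.1
  subst hp3
  exact X8.bsdp_erratum_of_onTreeGoodIMC hGZ hGZK hWu hK13 hnf hMaz hCST hFH hFH' h331 W 3 q hX
    (ClassX8.surj_of_semistable' W 3 hX hsst) hr hq2 hq hqns hram
    (fun K _ _ Dt H ι P hK hqD hsplit h2s hHp hP hc hPinf κ hκ γ _ 𝔭 h𝔭 he hf ↦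
      hA W (ClassX8.goodSS W 3 hX) hsst q hq2 hq hqns hram K Dt H ι P hK hqD hsplit h2s hHp hP hc hPinf κ hκ
        γ 𝔭 h𝔭 he hf)

end Summit.BirchSwinnertonDyer.BirchSwinnertonDyer.Theorems.X8ErratumField

end
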